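import Summits.QuantumFields.YangMills.Theorems.FluctuationComparisonRegPrIntLOrganTangentSqrtDecayOfRealDecay
import HarnessLib

/-!
# Crux `FluctuationComparisonRegPrIntL` (stmt-QuantumFields-20520, rung R3), PATH-B organ (covariant organ of record, RULING №56) — (L64) «THE COMPLEX MAJORANT FROM THE
# REAL KERNEL'S DECAY (TWO CONSTANTS)»: the last SHAPED letter on the complex side of the D0 whitening doors — the tube DECAY majorant (K-decay) of ✓(L62)∕✓(L63)
# «`‖Kc W i j′‖ ≤ a·e^{−κ₀ d₁}` on the tube» — is STRUCK.  Along each complex ONE-BOND SLICE (✓(L59) `exists_cplxSlice`) the entry family `u ↦ Kc (Sl u) i j′` is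
# holomorphic with a RATE-FREE bound `MK` ((K-bound), [Balaban1985BackgroundPropagators] Thm 3.4 p.400's sentence «can be extended to analytic functions … small
# perturbations of the operators depending on U only»), and at REAL parameters it IS the real operator `K` at a real small one-bond move, whose kernel decays
# ((K-decay-real), `aK·e^{−κK d₁}`); lit's TWO-CONSTANTS device ✓`B13RealSliceEntryLetters.rawEntryLetters_of_realSlice` ([Balaban1985BackgroundPropagators] Thm 3.10
# (3.107)–(3.108) p.416 read through [Ransford1995] Thm 4.3.7) then gives the complex majorant `aK^{1−λ(r′)}·MK^{λ(r′)}·e^{−(1−λ(r′))κK d₁}` on the shrunken slice ball — all that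
# ✓(L57) needs.  RESULT: the D0 whitening side asks of the COMPLEX extension ONLY holomorphy + a uniform bound (✓p828173's tube pair, entrywise), and everything else of the
# REAL operator: (K-real), (K-symm), (K-coer) = L2-a, (K-decay-real), a Combes–Thomas rate; L2-b and the complex majorant are DERIVED.

Cell `ym3-torus` (YM ladder rung R3 = continuum `SU(2)` Yang–Mills on the three-torus — a RUNG: NOT d = 4, NOT infinite volume, NOT a mass gap, NOT Clay).
Width seat `ym-ust-20520-w5` (gen 27), `--kind proof --supports stmt-QuantumFields-20520 --as helper`, count-neutral, DEFINITION-FREE, default heartbeats,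
no registry ∕ binder ∕ `Lines/` edit.  Over ✓p833103 (L57) `dwhite_of_whiteningKernel_coerciveCentre`, ✓p833825 (L59) `exists_cplxSlice`, (L63) `…SqrtDecayOfRealDecay`
(`norm_invSqrt_map_le_of_coercive_ct`, `ctRowSum∕ctColSum_le_of_expMajorant`), lit ✓`B13RealSliceEntryLetters` (`rawEntryLetters_of_realSlice`, `realStructureComplex`, `lam`,
`lam_nonneg`, `lam_lt_one`), lit ✓`B13AccretiveOfRealCoercive` §3 (`rowSum_decay_le`, `colSum_decay_le`), lit ✓`B13LocalKernelWalks.rowSum_torus`, ✓`plaqSmall_mono`,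
✓`plaqSmall_relPath`.

THE LETTERS OF THE FINAL EDITION (hypothesis texts; `θK := θ_j + 4·√3·rt` — every real one-bond move of size `< rt` of a `θ_j`-small field is `θK`-small):
* COMPLEX SIDE (✓p828173's currency, entrywise): (K-tube-holo) `DifferentiableOn ℂ (fun W => Kc W i j′) (cplxTube δt V)` and (K-bound) `‖Kc W i j′‖ ≤ MK` on the tube around
  every `θ_j`-small `V` — [Balaban1987RG1] (1.5)∕(1.18), [Balaban1985BackgroundPropagators] Thm 3.4 p.400 (L2-c, holomorphy + bound ONLY).
* REAL SIDE on `θK`: (K-real) `Kc (ι V′) = (K V′).map ofReal`; (K-symm) `(K V′).IsHermitian`; (K-coer) `Coercive (K V′) γK` — Thm 3.11 p.416 ∕ p.428 = L2-a AS PRINTED;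
  (K-decay-real) `|K V′ i j′| ≤ aK·e^{−κK d₁(loc i, loc j′)}`, `aK ≤ MK` — the real operator's kernel locality (Thm 3.10's operator half; [Balaban1988RG2Cluster] (2.5)).
* NUMBERS: fibre multiplicity `mf` of `loc`; a two-constants parameter `0 < r′ < 1` (slice ball `R := (r′∕(1+r′))·rt`, rate loss `λ(r′)`); a Combes–Thomas rate `0 ≤ κ < κK`
  with budget `aK·κ·(2∕(e(κK−κ)))·(mf·c₀(1,(κK−κ)∕2)^ν) ≤ ρct < γK`; the thin radius `R₁ ≤ R` with the margin condition at `S := aK^{1−λ}MK^{λ}·(mf·c₀(1,(1−λ)κK)^ν)`;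
  `0 < r < 1`, `δ₀ < (r∕(1+r))·R₁∕2`; (Wh-read-K) on `θ_j`; (z-window∣MW) `hwin`, `kW`, `hkW` at `(m, R, B, ρ) := (γK∕2, R₁, 2(√(γK−ρct))⁻¹, κ∕2)`.
INHABITATION (★★OWNER RULING №100): LAW-FREE — statements about the chart objects `Kc`, `K`, `Wh`, `coord`; no fibre law, no score, no cross-law object.

WHAT (sorry-free, def-free).
* §1 ★★★`dwhite_of_realKernel` — CONCLUSION = ✓(L52)'s = ✓`dlinkPath∕Square_of_dmin_dwhite`'s `hDwhite` text VERBATIM.  Proof: `choose` the slices (✓`exists_cplxSlice` at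
  radius `rt`); `A V b w u := Kc (Sl u)`; (W-holo) = tube holomorphy ∘ slice; the SLICE majorant by ✓`rawEntryLetters_of_realSlice realStructureComplex` from {(W-holo) on
  `ball 0 rt`, (K-bound) on the slice image, real-slice decay = (K-real) + (K-decay-real) at the real one-bond move (window `θK` by ✓`plaqSmall_relPath`)}; its row∕column
  sums by lit ✓`rowSum_decay_le`∕✓`colSum_decay_le` ∘ ✓`rowSum_torus`; (W-read0) = `Sl 0 = ι V` + (K-real); (W-coer) = (K-coer) by ✓`plaqSmall_mono`; (W-real) = (L63)
  §1∕§2 (Combes–Thomas, half rate); (W-read) = (K-real) + (Wh-read-K); then ✓(L57) by name at `R := (r′∕(1+r′))·rt`.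

HONEST FRAMING: bookkeeping + lit's kernel two-constants∕Combes–Thomas∕(2.7) chains; nothing of Bałaban's operators constructed or asserted; every letter OPEN (D0 = 19200
EX ∧ V2′; [Balaban1985BackgroundPropagators] §3) — in particular the m-UNIFORMITY of `MK`, `γK`, `(aK, κK)` on the unit-lattice indexing is Thm 3.4∕3.10∕3.11's content,
print's (UV3-NODE §92.2 L2-a∕L2-c; Combes–Thomas rates are per index step, §62.4 (iii)); (Dmin), (χ-Lip∣MW), (I-curv), (I-cov), KER′, rows v0.1–v0.4ᴱ UNDISCHARGED; the
five registered stubs of `Lines/semiclassical_s2beta.lean`, crux 20520 and `YM3TorusSU2` are NOT proved; registry untouched; rung R3 = SU(2) YM₃ on T³ — NOT d = 4, NOT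
infinite volume, NOT a mass gap, NOT Clay; the Yang–Mills mass gap is NOT proved.  [folklore]

References: T. Bałaban, CMP **99** (1985) 389–434 [Balaban1985BackgroundPropagators] (Thm 3.4 p.400, Thm 3.10 (3.107)–(3.108) pp.415–416, Thm 3.11 p.416, p.428); CMP
**116** (1988) 1–22 [Balaban1988RG2Cluster] ((2.5)–(2.7) pp.12–13, p.15); CMP **109** (1987) 249–301 [Balaban1987RG1] ((1.5) p.261, (1.11)–(1.18) pp.262–263); CMP **96**
(1984) 223–250 [Balaban1984PropagatorsII] (Lemma 2.1 (2.61) p.234); T. Ransford, *Potential Theory in the Complex Plane* (CUP 1995) Thm 4.3.7 [Ransford1995].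
-/

set_option autoImplicit false

noncomputable section

namespace Summit.QuantumFields.YangMills.Theorems.OrganTangentDwhiteOfRealKernel

open Function Set Metric Finset
open scoped NNReal Matrix Matrix.Norms.L2Operator
open Literature.MathematicalPhysics.QuantumFieldTheory
open Literature.MathematicalPhysics.QuantumFieldTheory.Balaban1983to89 T3ContinuumYM3Torus T3NestedUnitLaws
  T3UnitLawDensityEML T4Continuum BalabanUVClass T3UnitScaleTilt T3LevelShift T3TiltDescent
open T4CubeChartExp (expPt expPt_zero)
open BalabanUVClass (CplxModel)
open Literature.MathematicalPhysics.QuantumFieldTheory.Balaban1983to89.B9Thm37GlueTorus (tdist1 tdist1_nonneg)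
open Literature.MathematicalPhysics.QuantumFieldTheory.Balaban1983to89.B5TorusCover (UT)
open Literature.MathematicalPhysics.QuantumFieldTheory.Balaban1983to89.B13Sqrt27Accretive (invSqrt)
open Literature.MathematicalPhysics.QuantumFieldTheory.Balaban1983to89.B13RealSliceEntryLetters
  (realStructureComplex lam lam_nonneg lam_lt_one rawEntryLetters_of_realSlice)
open Literature.MathematicalPhysics.QuantumFieldTheory.Balaban1983to89.QGQInverse (Coercive)
open Literature.MathematicalPhysics.QuantumFieldTheory.Balaban1983to89.B13AccretiveOfRealCoercive (rowSum_decay_le colSum_decay_le)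
open Literature.MathematicalPhysics.QuantumFieldTheory.Balaban1983to89.B13LocalKernelWalks (rowSum_torus)
open Summit.QuantumFields.YangMills.Theorems.OrganTangentILawKnitFacts (plaqSmall_mono)
open Summit.QuantumFields.YangMills.Theorems.OrganTangentRelPathWindow (plaqSmall_relPath)
open Summit.QuantumFields.YangMills.Theorems.OrganTangentDwhiteOfRealCoercive (dwhite_of_whiteningKernel_coerciveCentre)
open Summit.QuantumFields.YangMills.Theorems.OrganTangentDwhiteOfTubeOperator (exists_cplxSlice)
open Summit.QuantumFields.YangMills.Theorems.OrganTangentSqrtDecayOfRealDecay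
  (norm_invSqrt_map_le_of_coercive_ct ctRowSum_le_of_expMajorant ctColSum_le_of_expMajorant)

section Dock

variable {ν : ℕ} {Nf : Fin ν → ℕ} [∀ i, NeZero (Nf i)]
variable {p : Type} [Fintype p] [DecidableEq p]

/-- ★★★ **(Dwhite∣MW) — THE FINAL EDITION: HOLOMORPHY + A UNIFORM BOUND ON THE COMPLEX SIDE, EVERYTHING ELSE REAL.**  Letters: (K-tube-holo) + (K-bound) on the tubes
around `θ_j`-small centres (✓p828173's pair, entrywise); on the window `θK := θ_j + 4·√3·rt`: (K-real), (K-symm), (K-coer) = L2-a, (K-decay-real) with `aK ≤ MK`; numbers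
`mf`, `r′`, `κ`, `ρct`, radii with the margin condition at `S := aK^{1−λ(r′)}·MK^{λ(r′)}·(mf·c₀(1,(1−λ(r′))κK)^ν)` and `R := (r′∕(1+r′))·rt`; (Wh-read-K); (z-window∣MW); `hkW` at
`(γK∕2, R₁, 2(√(γK−ρct))⁻¹, κ∕2)`.  CONCLUSION = ✓(L52)'s = ✓`dlinkPath∕Square_of_dmin_dwhite`'s `hDwhite` text VERBATIM.
[cite: Balaban1985BackgroundPropagators, Thm 3.4 p.400, Thm 3.10 (3.108) p.416, Thm 3.11 p.416, p.428; Balaban1988RG2Cluster, (2.5)-(2.7) pp.12-13, p.15; Balaban1987RG1, (1.11)-(1.18) pp.262-263; Ransford1995, Thm. 4.3.7] -/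
theorem dwhite_of_realKernel (F : T3Family) (γ b₀ p₀ : ℝ) (j Ts : ℕ) {Z : Type}
    (Φ : GaugeField (F.P j) 0 ↥(Matrix.specialUnitaryGroup (Fin 2) ℂ) × Z → GaugeField (F.P Ts) 0 ↥(Matrix.specialUnitaryGroup (Fin 2) ℂ))
    (Wh : GaugeField (F.P j) 0 ↥(Matrix.specialUnitaryGroup (Fin 2) ℂ) → Z → PBond (F.P Ts) 0 → (Fin 3 → ℝ))
    (loc : p → UT Nf) (idx : PBond (F.P Ts) 0 → Fin 3 → p) (coord : Z → p → ℂ)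
    (Kc : (PBond (F.P j) 0 → Matrix (Fin 2) (Fin 2) ℂ) → Matrix p p ℂ)
    (K : GaugeField (F.P j) 0 ↥(Matrix.specialUnitaryGroup (Fin 2) ℂ) → Matrix p p ℝ)
    (δt rt : ℝ) (hrt0 : 0 < rt) (hrt : Real.exp (6 * rt) ≤ 1 + δt)
    -- COMPLEX SIDE: holomorphy + ONE uniform entry bound on the tubes around every `θ_j`-small `V` (✓p828173's currency, entrywise)
    (hKc : ∀ V : GaugeField (F.P j) 0 ↥(Matrix.specialUnitaryGroup (Fin 2) ℂ), PlaqSmall (θBal F.L γ b₀ p₀ j) V →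
      ∀ i j', DifferentiableOn ℂ (fun W => Kc W i j') ((CplxModel.specialUnitary (Fin 2)).cplxTube δt V))
    (MK : ℝ)
    (hKM : ∀ V : GaugeField (F.P j) 0 ↥(Matrix.specialUnitaryGroup (Fin 2) ℂ), PlaqSmall (θBal F.L γ b₀ p₀ j) V →
      ∀ W ∈ (CplxModel.specialUnitary (Fin 2)).cplxTube δt V, ∀ i j', ‖Kc W i j'‖ ≤ MK)
    -- REAL SIDE on the window `θK := θ_j + 4·√3·rt`: reading, symmetry, coercivity (L2-a), kernel locality
    (hKreal : ∀ V' : GaugeField (F.P j) 0 ↥(Matrix.specialUnitaryGroup (Fin 2) ℂ), PlaqSmall (θBal F.L γ b₀ p₀ j + 4 * (Real.sqrt 3 * rt)) V' →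
      Kc ((CplxModel.specialUnitary (Fin 2)).embed V') = (K V').map (algebraMap ℝ ℂ))
    (hKs : ∀ V' : GaugeField (F.P j) 0 ↥(Matrix.specialUnitaryGroup (Fin 2) ℂ), PlaqSmall (θBal F.L γ b₀ p₀ j + 4 * (Real.sqrt 3 * rt)) V' → (K V').IsHermitian)
    (γK : ℝ) (hγK : 0 < γK)
    (hcoer : ∀ V' : GaugeField (F.P j) 0 ↥(Matrix.specialUnitaryGroup (Fin 2) ℂ), PlaqSmall (θBal F.L γ b₀ p₀ j + 4 * (Real.sqrt 3 * rt)) V' → Coercive (K V') γK)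
    (aK κK : ℝ) (haK : 0 ≤ aK) (haKM : aK ≤ MK) (hκK : 0 < κK)
    (hKd : ∀ V' : GaugeField (F.P j) 0 ↥(Matrix.specialUnitaryGroup (Fin 2) ℂ), PlaqSmall (θBal F.L γ b₀ p₀ j + 4 * (Real.sqrt 3 * rt)) V' →
      ∀ i j', |K V' i j'| ≤ aK * Real.exp (-(κK * tdist1 Nf (loc i) (loc j'))))
    -- NUMBERS: fibre multiplicity; two-constants parameter `r'`; thin radius with the margin condition; `r`, window bound, reading window
    (mf : ℕ) (hfib : ∀ y : UT Nf, (univ.filter fun k => loc k = y).card ≤ mf)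
    (r' R₁ r δ₀ Zw : ℝ) (hr'0 : 0 < r') (hr'1 : r' < 1) (hR₁ : 0 < R₁) (hR₁R : R₁ ≤ r' / (1 + r') * rt)
    (hsmall : 2 * (aK ^ (1 - lam r') * MK ^ lam r' * (mf * B6.c0 1 ((1 - lam r') * κK) ^ ν)) * R₁ / (r' / (1 + r') * rt) ≤ γK / 2)
    (hr0 : 0 < r) (hr1 : r < 1) (hZw : 0 ≤ Zw) (hδ₀R : δ₀ < r / (1 + r) * R₁ / 2)
    -- the Combes–Thomas rate and budget
    (κ ρct : ℝ) (hκ : 0 ≤ κ) (hκκK : κ < κK)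
    (hct : aK * κ * (2 / (Real.exp 1 * (κK - κ))) * (mf * B6.c0 1 ((κK - κ) / 2) ^ ν) ≤ ρct) (hρct : ρct < γK)
    -- (Wh-read-K)
    (hWh : ∀ V' : GaugeField (F.P j) 0 ↥(Matrix.specialUnitaryGroup (Fin 2) ℂ), PlaqSmall (θBal F.L γ b₀ p₀ j) V' →
      ∀ (z : Z) (e : PBond (F.P Ts) 0) (k : Fin 3), Wh V' z e k = ((invSqrt ((K V').map (algebraMap ℝ ℂ)) *ᵥ coord z) (idx e k)).re)
    -- (z-window∣MW) VERBATIM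
    (hwin : ∀ (z : Z) (V : GaugeField (F.P j) 0 ↥(Matrix.specialUnitaryGroup (Fin 2) ℂ)) (b : PBond (F.P j) 0) (u : Fin 3 → ℝ), PlaqSmall (θBal F.L γ b₀ p₀ j) V →
      PlaqSmall (θBal F.L γ b₀ p₀ j) (update V b (V b * expPt u)) → ‖u‖ ≤ δ₀ →
      (∀ r ∈ Set.Ioo (0:ℝ) 1, ∀ (n : ℕ) (hjn : j + 1 ≤ n) (hnK : n ≤ Ts), PlaqSmall (24 / 25 * θBal F.L γ b₀ p₀ n) (descendTo F ℰp n Ts hnK (Φ (update V b (V b * expPt (r • u)), z)))) →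
      ∀ j', ‖coord z j'‖ ≤ Zw)
    -- the consumer's modulus at `(m, R, B, ρ) := (γK∕2, R₁, 2(√(γK − ρct))⁻¹, κ∕2)`
    (kW : PBond (F.P Ts) 0 → ℝ)
    (hkW : ∀ e k, (4 / (r / (1 + r) * R₁)) *
          (∑ j', ((2 * (Real.sqrt (γK - ρct))⁻¹) ^ (1 - lam r) * (max (2 * (Real.sqrt (γK - ρct))⁻¹) (2 / Real.sqrt (γK / 2))) ^ lam r) *
            Real.exp (-((1 - lam r) * (κ / 2) * tdist1 Nf (loc (idx e k)) (loc j')))) * Zw ≤ kW e) :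
    ∀ (z : Z) (V : GaugeField (F.P j) 0 ↥(Matrix.specialUnitaryGroup (Fin 2) ℂ)) (b : PBond (F.P j) 0) (u : Fin 3 → ℝ), PlaqSmall (θBal F.L γ b₀ p₀ j) V →
      PlaqSmall (θBal F.L γ b₀ p₀ j) (update V b (V b * expPt u)) → ‖u‖ ≤ δ₀ →
      (∀ r ∈ Set.Ioo (0:ℝ) 1, ∀ (n : ℕ) (hjn : j + 1 ≤ n) (hnK : n ≤ Ts), PlaqSmall (24 / 25 * θBal F.L γ b₀ p₀ n) (descendTo F ℰp n Ts hnK (Φ (update V b (V b * expPt (r • u)), z)))) →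
      ∀ e, ‖Wh (update V b (V b * expPt u)) z e - Wh V z e‖ ≤ kW e * ‖u‖ := by
  classical
  have h3 : 0 ≤ Real.sqrt 3 := Real.sqrt_nonneg 3
  set R : ℝ := r' / (1 + r') * rt with hRdef
  have hR0 : 0 < R := by positivity
  have hRrt : R ≤ rt := by
    rw [hRdef]
    have : r' / (1 + r') ≤ 1 := (div_le_one (by linarith)).2 (by linarith)
    calc r' / (1 + r') * rt ≤ 1 * rt := mul_le_mul_of_nonneg_right this hrt0.le
      _ = rt := one_mul _
  have hlam0 : 0 ≤ lam r' := lam_nonneg hr'0.le hr'1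
  have hlam1 : lam r' < 1 := lam_lt_one r'
  have hρ' : 0 < (1 - lam r') * κK := mul_pos (by linarith) hκK
  -- windows: centres are `θK`-small; a real one-bond move of size `< rt` of a `θ_j`-small field is `θK`-small
  have hwinK : ∀ V : GaugeField (F.P j) 0 ↥(Matrix.specialUnitaryGroup (Fin 2) ℂ), PlaqSmall (θBal F.L γ b₀ p₀ j) V →
      PlaqSmall (θBal F.L γ b₀ p₀ j + 4 * (Real.sqrt 3 * rt)) V :=
    fun V hV => plaqSmall_mono (by nlinarith [hrt0.le]) hV
  have hroom : ∀ (V : GaugeField (F.P j) 0 ↥(Matrix.specialUnitaryGroup (Fin 2) ℂ)) (b : PBond (F.P j) 0) (w : Fin 3 → ℝ), ‖w‖ ≤ 1 →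
      PlaqSmall (θBal F.L γ b₀ p₀ j) V → ∀ s : ℝ, |s| < rt → PlaqSmall (θBal F.L γ b₀ p₀ j + 4 * (Real.sqrt 3 * rt)) (update V b (V b * expPt (s • w))) := by
    intro V b w hw hV s hs
    have h := plaqSmall_relPath (B' := b) (m' := s • w) (X := fun σ : ℝ => update V b (V b * expPt (σ • (s • w)))) hV
      (fun σ e he => update_of_ne he _ _) (fun σ => update_self _ _ _) 1
    simp only [one_smul, abs_one, one_mul] at h
    have hn : ‖s • w‖ ≤ rt := by
      calc ‖s • w‖ = |s| * ‖w‖ := by rw [norm_smul, Real.norm_eq_abs]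
        _ ≤ |s| * 1 := mul_le_mul_of_nonneg_left hw (abs_nonneg s)
        _ ≤ rt := by rw [mul_one]; exact hs.le
    exact plaqSmall_mono (by nlinarith [mul_le_mul_of_nonneg_left hn h3]) h
  -- the complex one-bond slices at radius `rt`
  choose Sl hSld hSlm hSl0 hSlr using
    fun (V : GaugeField (F.P j) 0 ↥(Matrix.specialUnitaryGroup (Fin 2) ℂ)) (b : PBond (F.P j) 0) (w : Fin 3 → ℝ) (hw : ‖w‖ ≤ 1) =>
      exists_cplxSlice V hrt0 hrt b w hw
  have hmove : ∀ (V : GaugeField (F.P j) 0 ↥(Matrix.specialUnitaryGroup (Fin 2) ℂ)) (b : PBond (F.P j) 0) (w : Fin 3 → ℝ) (hw : ‖w‖ ≤ 1) (s : ℝ),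
      Sl V b w hw (s : ℂ) = (CplxModel.specialUnitary (Fin 2)).embed (update V b (V b * expPt (s • w))) :=
    fun V b w hw s => hSlr V b w hw s _ (fun e he => update_of_ne he _ _) (update_self _ _ _)
  -- (K-sqrt-decay) at `(B, ρ) := (2(√(γK − ρct))⁻¹, κ∕2)` on `θK` from (L63) §1 ∘ §2
  have hdec : ∀ V' : GaugeField (F.P j) 0 ↥(Matrix.specialUnitaryGroup (Fin 2) ℂ), PlaqSmall (θBal F.L γ b₀ p₀ j + 4 * (Real.sqrt 3 * rt)) V' →
      ∀ i j', ‖invSqrt ((K V').map (algebraMap ℝ ℂ)) i j'‖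
        ≤ 2 * (Real.sqrt (γK - ρct))⁻¹ * Real.exp (-(κ / 2 * tdist1 Nf (loc i) (loc j'))) := by
    intro V' hV' i j'
    exact norm_invSqrt_map_le_of_coercive_ct loc (hKs V' hV') hρct hκ (hcoer V' hV')
      (fun i => (ctRowSum_le_of_expMajorant loc hκ hκκK hfib (hKd V' hV') i).trans hct)
      (fun j' => (ctColSum_le_of_expMajorant loc hκ hκκK hfib (hKd V' hV') j').trans hct) i j'
  -- the family and its slice-wise two-constants majorant
  have hMK0 : 0 ≤ MK := haK.trans haKM
  refine dwhite_of_whiteningKernel_coerciveCentre F γ b₀ p₀ j Ts Φ Wh loc idx coord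
    (fun V b w u => if hw : ‖w‖ ≤ 1 then Kc (Sl V b w hw u) else 0) K γK hγK ?_ (fun V hV => hcoer V (hwinK V hV))
    (fun i j' => aK ^ (1 - lam r') * MK ^ lam r' * Real.exp (-((1 - lam r') * κK * tdist1 Nf (loc i) (loc j'))))
    (aK ^ (1 - lam r') * MK ^ lam r' * (mf * B6.c0 1 ((1 - lam r') * κK) ^ ν))
    (by have := B6RandomWalk.c0_nonneg 1 ((1 - lam r') * κK); positivity)
    (rowSum_decay_le (by positivity) hfib (fun x => rowSum_torus Nf hρ' x))
    (colSum_decay_le (by positivity) hfib (fun x => rowSum_torus Nf hρ' x))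
    R R₁ (κ / 2) (2 * (Real.sqrt (γK - ρct))⁻¹) r δ₀ Zw hR₁ hR₁R hsmall (by positivity) (by positivity) hr0 hr1 hZw hδ₀R
    ?_ ?_ ?_ ?_ hwin kW hkW
  · -- (W-read0)
    intro V b w hV hw
    simp only [dif_pos hw]
    rw [hSl0, hKreal V (hwinK V hV)]
  · -- (W-holo) on `ball 0 R ⊆ ball 0 rt`
    intro V b w hV hw i j'
    simp only [dif_pos hw]
    exact ((hKc V hV i j').comp (hSld V b w hw).differentiableOn (hSlm V b w hw)).mono (ball_subset_ball hRrt)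
  · -- (W-maj) on `ball 0 R`: the two-constants majorant of the slice family from (K-bound) + real-slice decay
    intro V b w hV hw u hu i j'
    simp only [dif_pos hw]
    have hL := rawEntryLetters_of_realSlice realStructureComplex (Δ₀ := fun u => Kc (Sl V b w hw u)) (loc := loc)
      (R := rt) (ρ := κK) (B := aK) (Mb := MK) (r := r')
      (fun i j' => (hKc V hV i j').comp (hSld V b w hw).differentiableOn (hSlm V b w hw))
      (fun u hu i j' => hKM V hV _ (hSlm V b w hw hu) i j')
      (fun v hv hvR i j' => by
        obtain ⟨s, rfl⟩ := hv
        have hs : |s| < rt := by rwa [Complex.norm_real, Real.norm_eq_abs] at hvR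
        have hVs := hroom V b w hw hV s hs
        show ‖Kc (Sl V b w hw (s : ℂ)) i j'‖ ≤ _
        rw [hmove V b w hw s, hKreal _ hVs, Matrix.map_apply, Complex.coe_algebraMap, Complex.norm_real, Real.norm_eq_abs]
        exact hKd _ hVs i j')
      haK haKM hκK.le hr'0 hr'1
    exact hL.decay u hu i j'
  · -- (W-real) on `‖v‖ < R₁ ≤ R ≤ rt`: the real one-bond move is `θK`-small; (K-real) + (K-sqrt-decay)
    intro V b w hV hw v hv hvR i j'
    obtain ⟨s, rfl⟩ := hv
    have hs : |s| < rt := by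
      rw [Complex.norm_real, Real.norm_eq_abs] at hvR
      exact hvR.trans_le (hR₁R.trans hRrt)
    have hVs := hroom V b w hw hV s hs
    simp only [dif_pos hw]
    rw [hmove V b w hw s, hKreal _ hVs]
    exact hdec _ hVs i j'
  · -- (W-read)
    intro V b w s hV hw _ hVs z e k
    simp only [dif_pos hw]
    rw [hmove V b w hw s, hKreal _ (hwinK _ hVs)]
    exact hWh _ hVs z e k

end Dock

end Summit.QuantumFields.YangMills.Theorems.OrganTangentDwhiteOfRealKernel

end
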